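import Summits.MatrixMultiplication.MatrixMultiplication.Theorems.SubgroupIdentityDesigns.Negative.ReflectedTranslation
import Summits.MatrixMultiplication.MatrixMultiplication.Theorems.SubgroupIdentityDesigns.Negative.DualityTransport

/-!
# The dual reflected translation group (axis type) carries no level-one design
(cell B2b-5, gen 21)

VALUE = THEOREM on the level-one slice of `SubgroupIdentityDesigns` — NOT summit progress; the crux
(`stmt-MatrixMultiplication-14079`) is untouched.

`m = 3`, all odd `p`, every `ε`, no TPP.  `ReflectedTranslation` excludes the CENTRE-type group
`K = T(ℓ) ⋊ ⟨s⟩ = {R(a,b,±1)}` (all transvections with centre `ℓ`, and a reflection fixing `ℓ`).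
Its image under the automorphism `θ(g) = (g⁻¹)ᵀ` of `DualityTransport` is the AXIS-type group
`K^θ = T*(W) ⋊ ⟨s⟩ = {[[1,0,0],[a,1,0],[b,0,±1]]}`: all transvections with axis the hyperplane
`W = {v₀ = 0}` together with a reflection whose `(-1)`-eigenvector lies IN `W`.  `T(ℓ)` and `T*(W)`
are non-conjugate elementary abelian groups of order `p²` (centre type versus axis type), so `K^θ`
is a second conjugacy class of order-`2p²` groups in the member window; the set of non-carriers
is closed under `θ` (`DualityTransport.comp_dual_mem`), so with `K` (GAP catalogue at `(3,5)`,
ORACLE-g21 §G21-10b, kit j144577: order `50`, minimal, not a determinant cover) also `K^θ` is a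
catalogued minimal non-carrier.  By DESIGN TRANSPORT (`DualityTransport.design_dual`: a design
for `(H₁,H₂,H₃)` gives one for `(θH₁,θH₂,θH₃)`) every exclusion of `ReflectedTranslation`
transfers verbatim: `K^θ` lies in no member, and `T*(W)` in one member with `s` in another is
excluded as well.  No new computation — this file only records the dual class by name so that the
catalogue entry is a theorem for all odd `p`.
-/

open scoped BigOperators Classical Matrix

set_option linter.dupNamespace false

noncomputable section

namespace Summit.MatrixMultiplication.MatrixMultiplication.Theorems.SubgroupIdentityDesigns.Negative
namespace ReflectedTranslationDual

open Summit.MatrixMultiplication.MatrixMultiplication.Theorems.LieRankDesigns.Negative (GLm Mat)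
open Summit.MatrixMultiplication.MatrixMultiplication.Theorems.LevelOneGL2Designs.Negative
open ReflectedTranslation (RGL no_design_same₁ no_design_Ts₁₂ no_design_sT₁₂ no_design_Ts₁₃)
open DualityTransport (dual dual_dual design_dual)

variable {p : ℕ} [hp : Fact p.Prime]
variable {H₁ H₂ H₃ : Subgroup (GLm p 3)}

omit hp in
/-- `g = θ(θ g)` lies in `θ(H)` whenever `θ g ∈ H`. -/
theorem mem_map_dual_of_dual_mem {H : Subgroup (GLm p 3)} {g : GLm p 3} (h : dual g ∈ H) :
    g ∈ H.map dual :=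
  ⟨dual g, h, dual_dual g⟩

/-- **THE DUAL GROUP LIES IN NO MEMBER.**  If `H₁ ⊇ K^θ = {θ R(a,b,(-1)^j)}` (the axis-type
reflected translation group), there is no level-one identity design (`p` odd, `m = 3`, every `ε`,
no TPP needed; members `2, 3` by the symmetric argument or `DesignConjGL`/reversal). -/
theorem no_design_same₁ (hp2 : p ≠ 2)
    (hK : ∀ a b : ZMod p, ∀ j < 2, dual (RGL a b j : GLm p 3) ∈ H₁) :
    ¬ ∃ c : Mat p 3 → ℂ, (∀ M, 1 < M.rank → c M = 0) ∧
      (∑ M, c M * ZMod.stdAddChar (Matrix.trace (M * ((1 : GLm p 3) : Mat p 3)))) = 1 ∧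
      ∀ a ∈ H₁, ∀ b ∈ H₂, ∀ g ∈ H₃, a * b * g ≠ 1 →
        (∑ M, c M * ZMod.stdAddChar (Matrix.trace (M * ((a * b * g : GLm p 3) : Mat p 3)))) = 0 :=
  fun hdes =>
    ReflectedTranslation.no_design_same₁ (H₁ := H₁.map dual) (H₂ := H₂.map dual)
      (H₃ := H₃.map dual) hp2 (fun a b j hj => mem_map_dual_of_dual_mem (hK a b j hj))
      (design_dual hdes)

/-- **SPLIT, `T*(W) ≤ H₁`, `s ≤ H₂`.**  If `H₁ ⊇ θT(ℓ) = T*(W)` and `H₂ ∋ θs = s`, there is no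
level-one identity design. -/
theorem no_design_Ts₁₂ (hp2 : p ≠ 2) (hT : ∀ a b : ZMod p, dual (RGL a b 0 : GLm p 3) ∈ H₁)
    (hs : dual (RGL 0 0 1 : GLm p 3) ∈ H₂) :
    ¬ ∃ c : Mat p 3 → ℂ, (∀ M, 1 < M.rank → c M = 0) ∧
      (∑ M, c M * ZMod.stdAddChar (Matrix.trace (M * ((1 : GLm p 3) : Mat p 3)))) = 1 ∧
      ∀ a ∈ H₁, ∀ b ∈ H₂, ∀ g ∈ H₃, a * b * g ≠ 1 →
        (∑ M, c M * ZMod.stdAddChar (Matrix.trace (M * ((a * b * g : GLm p 3) : Mat p 3)))) = 0 :=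
  fun hdes =>
    ReflectedTranslation.no_design_Ts₁₂ (H₁ := H₁.map dual) (H₂ := H₂.map dual)
      (H₃ := H₃.map dual) hp2 (fun a b => mem_map_dual_of_dual_mem (hT a b))
      (mem_map_dual_of_dual_mem hs) (design_dual hdes)

/-- **SPLIT, `s ≤ H₁`, `T*(W) ≤ H₂`.** -/
theorem no_design_sT₁₂ (hp2 : p ≠ 2) (hs : dual (RGL 0 0 1 : GLm p 3) ∈ H₁)
    (hT : ∀ a b : ZMod p, dual (RGL a b 0 : GLm p 3) ∈ H₂) :
    ¬ ∃ c : Mat p 3 → ℂ, (∀ M, 1 < M.rank → c M = 0) ∧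
      (∑ M, c M * ZMod.stdAddChar (Matrix.trace (M * ((1 : GLm p 3) : Mat p 3)))) = 1 ∧
      ∀ a ∈ H₁, ∀ b ∈ H₂, ∀ g ∈ H₃, a * b * g ≠ 1 →
        (∑ M, c M * ZMod.stdAddChar (Matrix.trace (M * ((a * b * g : GLm p 3) : Mat p 3)))) = 0 :=
  fun hdes =>
    ReflectedTranslation.no_design_sT₁₂ (H₁ := H₁.map dual) (H₂ := H₂.map dual)
      (H₃ := H₃.map dual) hp2 (mem_map_dual_of_dual_mem hs)
      (fun a b => mem_map_dual_of_dual_mem (hT a b)) (design_dual hdes)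

/-- **SPLIT, `T*(W) ≤ H₁`, `s ≤ H₃`.** -/
theorem no_design_Ts₁₃ (hp2 : p ≠ 2) (hT : ∀ a b : ZMod p, dual (RGL a b 0 : GLm p 3) ∈ H₁)
    (hs : dual (RGL 0 0 1 : GLm p 3) ∈ H₃) :
    ¬ ∃ c : Mat p 3 → ℂ, (∀ M, 1 < M.rank → c M = 0) ∧
      (∑ M, c M * ZMod.stdAddChar (Matrix.trace (M * ((1 : GLm p 3) : Mat p 3)))) = 1 ∧
      ∀ a ∈ H₁, ∀ b ∈ H₂, ∀ g ∈ H₃, a * b * g ≠ 1 →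
        (∑ M, c M * ZMod.stdAddChar (Matrix.trace (M * ((a * b * g : GLm p 3) : Mat p 3)))) = 0 :=
  fun hdes =>
    ReflectedTranslation.no_design_Ts₁₃ (H₁ := H₁.map dual) (H₂ := H₂.map dual)
      (H₃ := H₃.map dual) hp2 (fun a b => mem_map_dual_of_dual_mem (hT a b))
      (mem_map_dual_of_dual_mem hs) (design_dual hdes)

/-- The dual elements explicitly: `θ R(a,b,(-1)^j) = [[1,0,0],[-a,1,0],[-(-1)^j b,0,(-1)^j]]`
(so `K^θ = {[[1,0,0],[a',1,0],[b',0,±1]]}` as claimed in the header). -/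
theorem coe_dual_RGL (a b : ZMod p) (j : ℕ) :
    ((dual (RGL a b j : GLm p 3) : GLm p 3) : Mat p 3) =
      !![1, 0, 0; -a, 1, 0; -(b * ReflectedTranslation.sg j), 0, ReflectedTranslation.sg j] := by
  rw [DualityTransport.coe_dual]
  show (ReflectedTranslation.Rmat (-a) (-(b * ReflectedTranslation.sg j))
    (ReflectedTranslation.sg j))ᵀ = _
  ext i k
  fin_cases i <;> fin_cases k <;> simp [ReflectedTranslation.Rmat, Matrix.transpose_apply]

end ReflectedTranslationDual
end Summit.MatrixMultiplication.MatrixMultiplication.Theorems.SubgroupIdentityDesigns.Negative
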